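import Summits.KontsevichZagierPeriods.KontsevichZagierPeriods.Theses.HurwitzMicroSectors
import Summits.KontsevichZagierPeriods.KontsevichZagierPeriods.Theorems.HurwitzMicroSectorsNormalFormPrinciplePiBoxTransfer

/-! TTRL-lite variant V2349 of stmt-KontsevichZagierPeriods-3869

Variant V2349 = `stub_boxRigidity` (BoxRigidity: two representations on open unit boxes with integrands
of KZ's rational shape and equal values are KZ-equivalent) under the TWO-sided small-case move
`fix_nat:m'=3; bound_nat:m≤2` (right dimension frozen to `3`, left dimension `m ≤ 2`). Verdict of the
attempt seat: **open** — this file is the certificate, not a proof of the variant. Unlike the one-sided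
moves (V2200, V2219, …, which are the whole leaf again), a joint bound DOES cut the leaf down: V2349 is
exactly **BoxVanishing in dimension `3`** — every box-rational representation on `(0,1)³` of value `0`
is a relation (`stub_boxRigidity_var2349_iff_boxVanishing_three`: pad the low-dimensional side to the
`3`-box by unit intervals, `pad_le`, subtract on the common box, `sub_same`, value `0` by soundness) —
equivalently BoxRigidity with BOTH dimensions `≤ 3` (`stub_boxRigidity_var2349_iff_boxRigidityLe_three`).
That is Conjecture 1 of Kontsevich–Zagier for all pairs of rational integrands on the boxes `(0,1)^{≤3}`:
it contains, unconditionally, Conjecture 1 on the level-`4` weight-`2` box sector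
(`sectorTwoFour_of_stub_boxRigidity_var2349`), which the tree proves only under the OPEN hypothesis
`LinearIndependent ℚ ![1, π², G]` (`CatalanSectorTwoFour`, stmt-KontsevichZagierPeriods-3877), and the
pairs `[1/(1−xyz)]` (value `ζ(3)`) versus `[a + b/(1−xy)]` (value `a + bπ²/6`), whose case split is the
open question `ζ(3) ∈ ℚ + ℚπ²`. It is implied by the Summit (`stub_boxRigidity_var2349_of_statement`),
so a refutation would refute Conjecture 1 for the tree's calculus. The proved two-sided instance is
`m, m' ≤ 1` (`boxRigidity_of_le_one`, Baker); `max (m, m') ≥ 2` already carries weight-two arithmetic.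
Source: M. Kontsevich, D. Zagier, *Periods* (2001), §1.2 Conjecture 1. Pure proof file, no definitions. -/

-- `Summit.<Summit>.<Problem>` is the tree's mandated summit-side namespace (CONVENTIONS §2); for this
-- single-conjunct summit the two coincide, so the duplicate is deliberate.
set_option linter.dupNamespace false

noncomputable section

namespace Summit.KontsevichZagierPeriods.KontsevichZagierPeriods.Theorems

open MeasureTheory Set
open Literature.NumberTheory.Transcendental Literature.NumberTheory.Transcendental.KZ
open Summit.KontsevichZagierPeriods.KontsevichZagierPeriods.Theses.HurwitzMicroSectors
open Summit.KontsevichZagierPeriods.HurwitzMicroSectors.NormalFormPrinciple.PiBox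
open Summit.KontsevichZagierPeriods.HurwitzMicroSectors.NormalFormPrinciple.PiBox.stub_boxCombineAux

/-! ## V2349 ⇒ BoxVanishing in dimension 3 -/

/-- **V2349 ⇒ BoxVanishing in dimension `3`**: compare a box-rational `N : IntegralRep 3` of value `0`
with the zero representation on the `0`-box (`m = 0 ≤ 2`; box-rational, value `0`, itself a relation).
[cite: KontsevichZagier2001, §1.2 Conjecture 1] -/
theorem boxVanishing_three_of_stub_boxRigidity_var2349
    (h : ∀ (m : ℕ) (N : IntegralRep m) (N' : IntegralRep 3), m ≤ 2 → N.domain = {x | ∀ i, x i ∈ Set.Ioo (0:ℝ) 1} → N.IsRational → N'.domain = {x | ∀ i, x i ∈ Set.Ioo (0:ℝ) 1} → N'.IsRational → N.value = N'.value → Equivalent N N')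
    (N : IntegralRep 3) (hNd : N.domain = {x | ∀ i, x i ∈ Set.Ioo (0:ℝ) 1}) (hNr : N.IsRational)
    (hv : N.value = 0) : of N ∈ relations := by
  obtain ⟨Z, hZd, hZi⟩ := exists_zeroRep (isSemialgebraic_box 0)
  have hZ : of Z ∈ relations := of_mem_relations_of_eqOn_zero Z (by simp [hZi, EqOn])
  have hZv : Z.value = 0 := by simp [IntegralRep.value, hZi]
  have hZr : Z.IsRational := ⟨0, 1, fun x _ => by simp, fun x _ => by simp [hZi]⟩
  have h' : of Z - of N ∈ relations := h 0 Z N (Nat.zero_le 2) hZd hZr hNd hNr (by rw [hv, hZv])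
  have := relations.sub_mem hZ h'
  rwa [sub_sub_cancel] at this

/-! ## BoxVanishing in dimension 3 ⇒ BoxRigidity with both dimensions ≤ 3 -/

/-- **BoxVanishing in dimension `3` ⇒ BoxRigidity for `m, m' ≤ 3`**: pad both representations to the
`3`-box by unit intervals (`pad_le`: one Newton–Leibniz move and two null faces per interval), subtract
the integrands on the common box (`sub_same`, rule 1b)); the difference is box-rational of value `0` by
soundness, hence a relation. [cite: KontsevichZagier2001, §1.2 Conjecture 1] -/
theorem boxRigidityLe_three_of_boxVanishing_three
    (hvan : ∀ (M : IntegralRep 3), M.domain = {x | ∀ i, x i ∈ Set.Ioo (0:ℝ) 1} → M.IsRational →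
      M.value = 0 → of M ∈ relations) :
    ∀ (m m' : ℕ) (N : IntegralRep m) (N' : IntegralRep m'), m ≤ 3 → m' ≤ 3 →
      N.domain = {x | ∀ i, x i ∈ Set.Ioo (0:ℝ) 1} → N.IsRational →
      N'.domain = {x | ∀ i, x i ∈ Set.Ioo (0:ℝ) 1} → N'.IsRational →
      N.value = N'.value → Equivalent N N' := by
  intro m m' N N' hm hm' hNd hNr hN'd hN'r hv
  obtain ⟨R₁, h₁d, h₁r, h₁⟩ := pad_le hm N hNd hNr
  obtain ⟨R₂, h₂d, h₂r, h₂⟩ := pad_le hm' N' hN'd hN'r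
  obtain ⟨M, hMd, hMr, hM⟩ := sub_same R₁ R₂ h₁d h₁r h₂d h₂r
  have hv₁ : N.value = R₁.value := Equivalent.value_eq_holds h₁
  have hv₂ : N'.value = R₂.value := Equivalent.value_eq_holds h₂
  have hv₁₂ : R₁.value = R₂.value := by rw [← hv₁, ← hv₂, hv]
  have hMv : M.value = 0 := by
    have e := relations_le_ker_eval_holds hM
    rw [AddMonoidHom.mem_ker, map_sub, map_sub, eval_of, eval_of, eval_of, hv₁₂, sub_self,
      zero_sub, neg_eq_zero] at e
    exact e
  have h₁₂ : of R₁ - of R₂ ∈ relations := by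
    have := relations.add_mem hM (hvan M hMd hMr hMv)
    rwa [sub_add_cancel] at this
  have e : of N - of N' = (of N - of R₁) + (of R₁ - of R₂) - (of N' - of R₂) := by abel
  show of N - of N' ∈ relations
  rw [e]
  exact relations.sub_mem (relations.add_mem h₁ h₁₂) h₂

/-! ## The variant V2349 itself -/

/-- **V2349 ⟺ BoxVanishing in dimension `3`.** [cite: KontsevichZagier2001, §1.2 Conjecture 1] -/
theorem stub_boxRigidity_var2349_iff_boxVanishing_three :
    (∀ (m : ℕ) (N : IntegralRep m) (N' : IntegralRep 3), m ≤ 2 → N.domain = {x | ∀ i, x i ∈ Set.Ioo (0:ℝ) 1} → N.IsRational → N'.domain = {x | ∀ i, x i ∈ Set.Ioo (0:ℝ) 1} → N'.IsRational → N.value = N'.value → Equivalent N N') ↔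
    (∀ (M : IntegralRep 3), M.domain = {x | ∀ i, x i ∈ Set.Ioo (0:ℝ) 1} → M.IsRational →
      M.value = 0 → of M ∈ relations) :=
  ⟨boxVanishing_three_of_stub_boxRigidity_var2349,
    fun hvan m N N' hm => boxRigidityLe_three_of_boxVanishing_three hvan m 3 N N'
      (hm.trans (by norm_num)) le_rfl⟩

/-- **V2349 ⟺ BoxRigidity with both dimensions `≤ 3`** (the honest strength of the variant: Conjecture 1
for all pairs of rational integrands on the open unit boxes of dimension at most `3`).
[cite: KontsevichZagier2001, §1.2 Conjecture 1] -/
theorem stub_boxRigidity_var2349_iff_boxRigidityLe_three :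
    (∀ (m : ℕ) (N : IntegralRep m) (N' : IntegralRep 3), m ≤ 2 → N.domain = {x | ∀ i, x i ∈ Set.Ioo (0:ℝ) 1} → N.IsRational → N'.domain = {x | ∀ i, x i ∈ Set.Ioo (0:ℝ) 1} → N'.IsRational → N.value = N'.value → Equivalent N N') ↔
    (∀ (m m' : ℕ) (N : IntegralRep m) (N' : IntegralRep m'), m ≤ 3 → m' ≤ 3 →
      N.domain = {x | ∀ i, x i ∈ Set.Ioo (0:ℝ) 1} → N.IsRational →
      N'.domain = {x | ∀ i, x i ∈ Set.Ioo (0:ℝ) 1} → N'.IsRational →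
      N.value = N'.value → Equivalent N N') :=
  ⟨fun h => boxRigidityLe_three_of_boxVanishing_three (boxVanishing_three_of_stub_boxRigidity_var2349 h),
    fun h m N N' hm => h m 3 N N' (hm.trans (by norm_num)) le_rfl⟩

/-- **The parent leaf ⇒ V2349** (specialisation). [cite: KontsevichZagier2001, §1.2 Conjecture 1] -/
theorem stub_boxRigidity_var2349_of_parent
    (h : ∀ (m m' : ℕ) (N : IntegralRep m) (N' : IntegralRep m'), N.domain = {x | ∀ i, x i ∈ Set.Ioo (0:ℝ) 1} → N.IsRational → N'.domain = {x | ∀ i, x i ∈ Set.Ioo (0:ℝ) 1} → N'.IsRational → N.value = N'.value → Equivalent N N') :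
    ∀ (m : ℕ) (N : IntegralRep m) (N' : IntegralRep 3), m ≤ 2 → N.domain = {x | ∀ i, x i ∈ Set.Ioo (0:ℝ) 1} → N.IsRational → N'.domain = {x | ∀ i, x i ∈ Set.Ioo (0:ℝ) 1} → N'.IsRational → N.value = N'.value → Equivalent N N' :=
  fun m N N' _ => h m 3 N N'

/-- **`KontsevichZagierPeriods ⇒ V2349`**: the variant is a special case of Conjecture 1 for the tree's
calculus — a refutation of the variant would refute the Summit. [cite: KontsevichZagier2001, §1.2 Conjecture 1] -/
theorem stub_boxRigidity_var2349_of_statement (h : _root_.KontsevichZagierPeriods) :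
    ∀ (m : ℕ) (N : IntegralRep m) (N' : IntegralRep 3), m ≤ 2 → N.domain = {x | ∀ i, x i ∈ Set.Ioo (0:ℝ) 1} → N.IsRational → N'.domain = {x | ∀ i, x i ∈ Set.Ioo (0:ℝ) 1} → N'.IsRational → N.value = N'.value → Equivalent N N' :=
  stub_boxRigidity_var2349_of_parent (leaves_of_statement h).1

/-! ## What the variant still contains: the weight-two box sectors, unconditionally -/

/-- A representation on the open unit square whose integrand is `P(xy)/(1 − (xy)^k)` on it (`k ≠ 0`,
`P ∈ ℚ[t]`) has KZ's rational shape: `p = P(X₀X₁)`, `q = 1 − (X₀X₁)^k`, and `q > 0` on the box.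
[cite: KontsevichZagier2001, §1.1 Definition] -/
theorem isRational_of_eqOn_sector (k : ℕ) (hk : k ≠ 0) (r : IntegralRep 2) (P : Polynomial ℚ)
    (hrd : r.domain = {x | ∀ i, x i ∈ Set.Ioo (0:ℝ) 1})
    (hri : Set.EqOn r.integrand (fun x => Polynomial.aeval (x 0 * x 1) P / (1 - (x 0 * x 1) ^ k)) r.domain) :
    r.IsRational := by
  refine ⟨Polynomial.aeval (MvPolynomial.X 0 * MvPolynomial.X 1 : MvPolynomial (Fin 2) ℚ) P,
    1 - (MvPolynomial.X 0 * MvPolynomial.X 1) ^ k, fun x hx => ?_, fun x hx => ?_⟩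
  · rw [hrd] at hx
    have h0 := hx 0
    have h1 := hx 1
    simp only [Set.mem_Ioo] at h0 h1
    have hlt : (x 0 * x 1) ^ k < 1 :=
      pow_lt_one₀ (mul_nonneg h0.1.le h1.1.le) (mul_lt_one_of_nonneg_of_lt_one_left h0.1.le h0.2 h1.2.le) hk
    simp only [map_sub, map_one, map_pow, map_mul, MvPolynomial.aeval_X]
    exact (sub_pos.2 hlt).ne'
  · rw [hri hx]
    simp only [map_sub, map_one, map_pow, map_mul, MvPolynomial.aeval_X,
      ← Polynomial.aeval_algHom_apply]

/-- **V2349 ⇒ Conjecture 1 on EVERY weight-`2` box sector `P(xy)/(1 − (xy)^k)`, unconditionally**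
(`k ≠ 0`; values in the `ℚ`-span of `1` and the level-`k` Hurwitz values `ζ(2, j/k)`): the tree closes
such a sector only by reduction–rigidity with a linear-independence THEOREM as rigidity input
(`k = 6`: Calegari–Dimitrov–Tang 2024, entered as a hypothesis of `SectorTwoSix`; `k = 4`: the OPEN
independence of `1, π², G`, hypothesis of `CatalanSectorTwoFour`; general `k`: Milnor's conjecture on
Hurwitz values). A proof of V2349 from the tree would have to supply that input for every `k` at once.
[cite: KontsevichZagier2001, §1.2 Conjecture 1] -/
theorem sectorTwoLevel_of_stub_boxRigidity_var2349
    (h : ∀ (m : ℕ) (N : IntegralRep m) (N' : IntegralRep 3), m ≤ 2 → N.domain = {x | ∀ i, x i ∈ Set.Ioo (0:ℝ) 1} → N.IsRational → N'.domain = {x | ∀ i, x i ∈ Set.Ioo (0:ℝ) 1} → N'.IsRational → N.value = N'.value → Equivalent N N')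
    (k : ℕ) (hk : k ≠ 0) :
    ∀ (r r' : IntegralRep 2) (P P' : Polynomial ℚ), r.domain = {x | ∀ i, x i ∈ Set.Ioo (0:ℝ) 1} → r'.domain = {x | ∀ i, x i ∈ Set.Ioo (0:ℝ) 1} → Set.EqOn r.integrand (fun x => Polynomial.aeval (x 0 * x 1) P / (1 - (x 0 * x 1) ^ k)) r.domain → Set.EqOn r'.integrand (fun x => Polynomial.aeval (x 0 * x 1) P' / (1 - (x 0 * x 1) ^ k)) r'.domain → r.value = r'.value → Equivalent r r' :=
  fun r r' P P' hrd hr'd hri hr'i hv =>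
    (stub_boxRigidity_var2349_iff_boxRigidityLe_three.1 h) 2 2 r r' (by norm_num) (by norm_num)
      hrd (isRational_of_eqOn_sector k hk r P hrd hri)
      hr'd (isRational_of_eqOn_sector k hk r' P' hr'd hr'i) hv

/-- **V2349 ⇒ Conjecture 1 on the level-`4` weight-`2` box sector, unconditionally** — verbatim the
conclusion of `CatalanSectorTwoFour` (stmt-KontsevichZagierPeriods-3877) WITHOUT its hypothesis
`LinearIndependent ℚ ![1, π², G]` (irrationality of Catalan's constant and more: open); e.g. for the pair
`[1/(1 + x²y²)]` (value `G`) and a rational constant `[q]` the case split is `G = q`.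
[cite: KontsevichZagier2001, §1.2 Conjecture 1] -/
theorem sectorTwoFour_of_stub_boxRigidity_var2349
    (h : ∀ (m : ℕ) (N : IntegralRep m) (N' : IntegralRep 3), m ≤ 2 → N.domain = {x | ∀ i, x i ∈ Set.Ioo (0:ℝ) 1} → N.IsRational → N'.domain = {x | ∀ i, x i ∈ Set.Ioo (0:ℝ) 1} → N'.IsRational → N.value = N'.value → Equivalent N N') :
    ∀ (r r' : IntegralRep 2) (P P' : Polynomial ℚ), r.domain = {x | ∀ i, x i ∈ Set.Ioo (0:ℝ) 1} → r'.domain = {x | ∀ i, x i ∈ Set.Ioo (0:ℝ) 1} → Set.EqOn r.integrand (fun x => Polynomial.aeval (x 0 * x 1) P / (1 - (x 0 * x 1) ^ 4)) r.domain → Set.EqOn r'.integrand (fun x => Polynomial.aeval (x 0 * x 1) P' / (1 - (x 0 * x 1) ^ 4)) r'.domain → r.value = r'.value → Equivalent r r' :=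
  sectorTwoLevel_of_stub_boxRigidity_var2349 h 4 (by norm_num)

end Summit.KontsevichZagierPeriods.KontsevichZagierPeriods.Theorems
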